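import Literature.Computability.Complexity.ACFourierTails
import HarnessLib

/-!
# Crux `MobiusLadder.LiouvilleOrthogonalTC0` (stmt-QuantumAdvantage-1393), line `Sketch`, skeleton v11:
stub `stub_roundFamily` — Tal's round surgery for a family of layered formulas

At a good leaf `τ` of the common partial decision tree of one switching round (every `nf`
subformula of every member `F a` of the family has a depth-`ℓ` decision tree under `τ`, and so does
every member of height `≤ 2`), the family `F : Fin K → ACForm n` (heights `≤ H + 1`, bottom fan-in
`≤ t ≤ ℓ`) is replaced by a family `F'` computing the restrictions `F a|τ`, of heights `≤ H`, bottom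
fan-in `≤ ℓ` and no larger effective sizes. Member by member (`StubRoundFamily.exists_round`), by
cases on the top constructor, reusing the single-formula machinery of
`Literature/Computability/Complexity/ACFourierTails.lean` (Tal 2017, proof of Theorem 3.6):

* a bottom gate `tm op lits` (height `1`) is restricted (`ACForm.restrictTm`, `eval_restrictTm`,
  `restrictTm_shape`: again a bottom gate, of no larger width, effective size `0`);
* a depth-2 subcircuit `nf op cls` (height `2`) is replaced by the DNF of its decision tree
  (`ACForm.pieces`, `eval_nf_pieces`, `length_le_of_mem_pieces`: height `2 ≤ H`, width `≤ ℓ`,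
  effective size `1`);
* a gate (height `≥ 3`) is rounded (`ACForm.round`, `eval_round`, `height_round_gate`,
  `width_round_le`, `esize_round_le`).

* `StubRoundFamily.exists_round` — one member; `stub_roundFamily` — the registered stub (verbatim),
  by `choose`.
-/

set_option linter.dupNamespace false -- D-0017: single-problem summit ⇒ `QuantumAdvantage.QuantumAdvantage` by design

noncomputable section

namespace Summit.QuantumAdvantage.QuantumAdvantage.Theorems.LiouvilleOrthogonalTC0

open Finset
open Literature.Computability.Complexity

namespace StubRoundFamily

variable {n : ℕ}

/-- **One member of the rounded family.** A layered formula `f` of height `≤ H + 1` (`H ≥ 2`) and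
bottom fan-in `≤ t ≤ ℓ` (`ℓ ≥ 1`), all of whose `nf` subformulas have depth-`ℓ` decision trees under
`τ`, and which has one itself if its height is `≤ 2`, has a replacement `f'` of height `≤ H`, bottom
fan-in `≤ ℓ`, effective size `≤ esize f`, computing `f|τ`: `restrictTm` for a bottom gate, the DNF of
the decision tree for a depth-2 subcircuit, `round` for a gate. [cite: Tal2017, Theorem 3.6] -/
theorem exists_round {H t ℓ : ℕ} (hℓ : 1 ≤ ℓ) (htℓ : t ≤ ℓ) (hH : 2 ≤ H)
    (f : ACForm n) (hh : f.height ≤ H + 1) (hw : f.width ≤ t)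
    (τ : PAssign n) (hgood : ∀ c ∈ ACForm.subNF f, ACForm.HasDT τ ℓ c)
    (hlow : f.height ≤ 2 → ACForm.HasDT τ ℓ f) :
    ∃ f' : ACForm n, f'.height ≤ H ∧ f'.width ≤ ℓ ∧ f'.esize ≤ f.esize ∧
      ∀ x, f'.eval x = f.eval (τ.apply x) := by
  cases f with
  | tm op lits =>
    -- height 1: restrict the bottom gate
    obtain ⟨op', lits', hr, hlen⟩ := ACForm.restrictTm_shape τ op lits
    refine ⟨ACForm.restrictTm τ op lits, ?_, ?_, ?_, fun x => ACForm.eval_restrictTm τ op lits x⟩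
    · rw [hr]; simp only [ACForm.height]; omega
    · rw [hr]; simp only [ACForm.width] at hw ⊢; omega
    · rw [hr]; simp [ACForm.esize, ACForm.subG]
  | nf op cls =>
    -- height 2: the DNF of the decision tree of `f|τ`
    have hdt : ACForm.HasDT τ ℓ (ACForm.nf op cls) := hlow (by simp [ACForm.height])
    refine ⟨ACForm.nf true (ACForm.pieces τ ℓ true (ACForm.nf op cls)), ?_, ?_, ?_,
      fun x => ACForm.eval_nf_pieces τ ℓ hdt true x⟩
    · simpa only [ACForm.height] using hH
    · rw [ACForm.width_nf_le_iff]; exact ACForm.length_le_of_mem_pieces τ ℓ true _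
    · simp [ACForm.esize, ACForm.subG]
  | gate op cs =>
    -- height ≥ 3: Tal's round transformation
    have h3 : 3 ≤ (ACForm.gate op cs).height := by simp [ACForm.height]
    refine ⟨ACForm.round τ ℓ (ACForm.gate op cs), ?_, ?_, ACForm.esize_round_le τ ℓ _ h3,
      fun x => ACForm.eval_round τ ℓ _ hgood (by omega) x⟩
    · have := ACForm.height_round_gate τ ℓ (ACForm.gate op cs) h3; omega
    · exact (ACForm.width_round_le τ ℓ (ACForm.gate op cs) h3).trans
        (max_le (hw.trans htℓ) (max_le le_rfl hℓ))

end StubRoundFamily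

/-- **Registered stub `stub_roundFamily` (v11): Tal's round surgery for a family of layered
formulas.** At a good leaf `τ` of the common restriction tree — every `nf` (height-2) subformula of
every member `F a` has a depth-`ℓ` decision tree under `τ` (`hgood`, i.e. `ACForm.Good τ ℓ (F a)`), and
so does every member of height `≤ 2` (`hlow`) — a family of heights `≤ H + 1`, bottom fan-in
`≤ t ≤ ℓ` is replaced by a family `F'` computing the restrictions `(F a)|τ`, one level lower
(heights `≤ H`), of bottom fan-in `≤ ℓ` and no larger effective sizes
(`StubRoundFamily.exists_round` member by member, assembled by choice). [cite: Tal2017, Theorem 3.6] -/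
theorem stub_roundFamily {n K H t ℓ : ℕ} (hℓ : 1 ≤ ℓ) (htℓ : t ≤ ℓ) (hH : 2 ≤ H)
    (F : Fin K → ACForm n) (hh : ∀ a, (F a).height ≤ H + 1) (hw : ∀ a, (F a).width ≤ t)
    (τ : PAssign n) (hgood : ∀ a, ∀ c ∈ ACForm.subNF (F a), ACForm.HasDT τ ℓ c)
    (hlow : ∀ a, (F a).height ≤ 2 → ACForm.HasDT τ ℓ (F a)) :
    ∃ F' : Fin K → ACForm n, (∀ a, (F' a).height ≤ H) ∧ (∀ a, (F' a).width ≤ ℓ) ∧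
      (∀ a, (F' a).esize ≤ (F a).esize) ∧ ∀ a x, (F' a).eval x = (F a).eval (τ.apply x) := by
  choose r hrh hrw hre hrev using fun a =>
    StubRoundFamily.exists_round hℓ htℓ hH (F a) (hh a) (hw a) τ (hgood a) (hlow a)
  exact ⟨r, hrh, hrw, hre, hrev⟩

end Summit.QuantumAdvantage.QuantumAdvantage.Theorems.LiouvilleOrthogonalTC0
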